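import Summits.Ventures.PercRepro.SixThreeFrame
import Summits.Ventures.PercRepro.SixThreePlane
import Summits.Ventures.PercRepro.SixThreeReduce
import Summits.Ventures.PercRepro.SixThreeBridge

/-!
# PercRepro — the compositions: C-025 at `(6, 3)` on every finite matroid modulo the named residues (p2, gen 6)

Three corollaries of `SixThreeFrame.lean`'s `c025_six_three_of_perPlane` with the soft max-trace rule
(`SixThreeRule.lean`, θ = 6):
* `c025_six_three_of_P1`: from Theorem P₁ (coindependent planes) and the per-plane inequality on the planes with
  `ρ(E ∖ G) ≤ 5`;
* `c025_six_three_of_P1_planar`: from Theorem P₁ and the three planar inequalities `PlanarIneqs` (`SixThreeReduce.lean`);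
* `c025_six_three_of_P1_table`: from Theorem P₁, the numerical table `TableIneq12` (types `1`, `2`), the raw type-`3`
  inequality (`SixThreeBridge.lean`; the `3`-point planes are `planarIneqs_of_three_points`);
* `c025_six_three_of_P1_tables`: from Theorem P₁ and the three PROFILE TABLES (`TableIneqAdd12`, the type-`3` general
  and two-line rows with `C2gen`) — the exact shape of p3's additive table.
-/

namespace PercRepro

/-- **C-025 at `(6, 3)` on every finite matroid, modulo Theorem P₁ and the small planes.**  With the planes-only soft
max-trace rule `f(P, S) = 6^{|S ∩ P| − 3} · [ρ(S ∩ P) = 3]` (θ = 6): if on every simple matroid of rank `≥ 6`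
(coloop-free at rank `6`)
* `hP₁`: every triple `T` of rank `3` with spanning complement and every independent `6`-set `W` outside its plane
  satisfy `Σ_{S ∈ Y, S ∩ cl(T) = T, S ∖ cl(T) ⊆ W} w(cl(T), S) ≥ 3` (mine-2's Theorem P₁, primal form §19.4′), and
* `hsmall`: every plane `G` with `ρ(E ∖ G) ≤ 5` satisfies the per-plane inequality `3 · #U_G ≤ Σ_S w(G, S)`
  (mine-2's `(I₁)`–`(I₃)`),
then `3 · #{A ⊆ E : ρ(A) = 6, ρ(E ∖ A) = 3} ≤ #{A ⊆ E : 3 < ρ(A) < 6}` for every finite matroid. -/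
theorem c025_six_three_of_P1 {α : Type} [DecidableEq α]
    (hP₁ : ∀ (M : Matroid α) [M.Finite], ThmH.Simple M → (6 : ℕ∞) ≤ M.eRank →
      (M.eRank = 6 → ∀ e, ¬ M.IsColoop e) → ∀ G ∈ ThmH.planes M, ∀ T ∈ PerFlat.UqG M 6 3 G, T.card = 3 →
      ∀ W ⊆ ThmH.gr M \ G, M.Indep (W : Set α) → W.card = 6 →
      (3 : ℚ) ≤ ∑ S ∈ (PerFlat.Yq M 6 3).filter (fun S => S ∩ G = T ∧ S \ G ⊆ W),
        SixThree.fRule M G S / SixThree.D M S)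
    (hsmall : ∀ (M : Matroid α) [M.Finite], ThmH.Simple M → (6 : ℕ∞) ≤ M.eRank →
      (M.eRank = 6 → ∀ e, ¬ M.IsColoop e) → ∀ G ∈ ThmH.planes M, M.eRk ((ThmH.gr M \ G : Finset α) : Set α) ≤ 5 →
      (3 : ℚ) * ((PerFlat.UqG M 6 3 G).card : ℚ) ≤
        ∑ S ∈ PerFlat.Yq M 6 3, SixThree.fRule M G S / ∑ G' ∈ ThmH.planes M, SixThree.fRule M G' S)
    (M : Matroid α) [M.Finite] :
    phiK 6 3 * ({A : Set α | A ⊆ M.E ∧ M.eRk A = ((6 : ℕ) : ℕ∞) ∧ M.eRk (M.E \ A) = ((3 : ℕ) : ℕ∞)}.ncard : ℚ) ≤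
      ({A : Set α | A ⊆ M.E ∧ ((3 : ℕ) : ℕ∞) < M.eRk A ∧ M.eRk A < ((6 : ℕ) : ℕ∞)}.ncard : ℚ) := by
  apply c025_six_three_of_perPlane (fun M _ => SixThree.fRule M) (fun M _ => SixThree.fRule_nonneg M)
  intro M _ hs hge hcol G hG
  by_cases hW : M.eRk ((ThmH.gr M \ G : Finset α) : Set α) ≤ 5
  · exact hsmall M hs hge hcol G hG hW
  · push Not at hW
    exact SixThree.perPlane_of_six_le hs hG (Order.add_one_le_of_lt hW) (hP₁ M hs hge hcol G hG)


/-- **C-025 at `(6, 3)` on every finite matroid from Theorem P₁ and the planar inequalities.**  If on every simple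
matroid of rank `≥ 6` (coloop-free at rank `6`)
* `hP₁`: every rank-`3` triple with spanning complement has supply `≥ 3` in its plane (Theorem P₁), and
* `hI`: every plane with `ρ(E ∖ G) ≤ 5` satisfies `SixThree.PlanarIneqs` (mine-2's `(I₁)`–`(I₃)`),
then `Φ(6,3) · #U(6,3) ≤ #Y(6,3)` for every finite matroid. -/
theorem c025_six_three_of_P1_planar {α : Type} [DecidableEq α]
    (hP₁ : ∀ (M : Matroid α) [M.Finite], ThmH.Simple M → (6 : ℕ∞) ≤ M.eRank →
      (M.eRank = 6 → ∀ e, ¬ M.IsColoop e) → ∀ G ∈ ThmH.planes M, ∀ T ∈ PerFlat.UqG M 6 3 G, T.card = 3 →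
      ∀ W ⊆ ThmH.gr M \ G, M.Indep (W : Set α) → W.card = 6 →
      (3 : ℚ) ≤ ∑ S ∈ (PerFlat.Yq M 6 3).filter (fun S => S ∩ G = T ∧ S \ G ⊆ W),
        SixThree.fRule M G S / SixThree.D M S)
    (hI : ∀ (M : Matroid α) [M.Finite], ThmH.Simple M → (6 : ℕ∞) ≤ M.eRank →
      (M.eRank = 6 → ∀ e, ¬ M.IsColoop e) → ∀ G ∈ ThmH.planes M, M.eRk ((ThmH.gr M \ G : Finset α) : Set α) ≤ 5 →
      SixThree.PlanarIneqs M G)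
    (M : Matroid α) [M.Finite] :
    phiK 6 3 * ({A : Set α | A ⊆ M.E ∧ M.eRk A = ((6 : ℕ) : ℕ∞) ∧ M.eRk (M.E \ A) = ((3 : ℕ) : ℕ∞)}.ncard : ℚ) ≤
      ({A : Set α | A ⊆ M.E ∧ ((3 : ℕ) : ℕ∞) < M.eRk A ∧ M.eRk A < ((6 : ℕ) : ℕ∞)}.ncard : ℚ) := by
  apply c025_six_three_of_P1 hP₁
  intro M _ hs hge hcol G hG hW5
  exact SixThree.perPlane_small_of_planar hs hG hge hW5 (hI M hs hge hcol G hG hW5)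


/-- **C-025 at `(6, 3)` on every finite matroid from Theorem P₁, the type-`1`/`2` table and the type-`3` residue.**
If on every simple matroid of rank `≥ 6` (coloop-free at rank `6`): `hP₁` (Theorem P₁); every plane `G` with
`ρ(E ∖ G) ≤ 5` and `g ≥ 4` points satisfies the table inequalities `TableIneq12 g (prof G)`; every such plane with
`ρ(E ∖ G) = 3` satisfies the raw type-`3` inequality — then
`Φ(6,3) · #U(6,3) ≤ #Y(6,3)` for every finite matroid. -/
theorem c025_six_three_of_P1_table {α : Type} [DecidableEq α]
    (hP₁ : ∀ (M : Matroid α) [M.Finite], ThmH.Simple M → (6 : ℕ∞) ≤ M.eRank →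
      (M.eRank = 6 → ∀ e, ¬ M.IsColoop e) → ∀ G ∈ ThmH.planes M, ∀ T ∈ PerFlat.UqG M 6 3 G, T.card = 3 →
      ∀ W ⊆ ThmH.gr M \ G, M.Indep (W : Set α) → W.card = 6 →
      (3 : ℚ) ≤ ∑ S ∈ (PerFlat.Yq M 6 3).filter (fun S => S ∩ G = T ∧ S \ G ⊆ W),
        SixThree.fRule M G S / SixThree.D M S)
    (hTab : ∀ (M : Matroid α) [M.Finite], ThmH.Simple M → (6 : ℕ∞) ≤ M.eRank →
      (M.eRank = 6 → ∀ e, ¬ M.IsColoop e) → ∀ G ∈ ThmH.planes M, M.eRk ((ThmH.gr M \ G : Finset α) : Set α) ≤ 5 → 4 ≤ G.card →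
      SixThree.TableIneq12 G.card (SixThree.prof M G))
    (h3 : ∀ (M : Matroid α) [M.Finite], ThmH.Simple M → (6 : ℕ∞) ≤ M.eRank →
      (M.eRank = 6 → ∀ e, ¬ M.IsColoop e) → ∀ G ∈ ThmH.planes M, M.eRk ((ThmH.gr M \ G : Finset α) : Set α) ≤ 5 → 4 ≤ G.card →
      M.eRk ((ThmH.gr M \ G : Finset α) : Set α) = 3 →
      3 * ((((SixThree.R3 M G).filter (fun B : Finset α => M.eRk ((G \ B : Finset α) : Set α) = 3)).card : ℚ)) ≤
        ∑ B ∈ SixThree.R3 M G, SixThree.vSupply M B 3)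
    (M : Matroid α) [M.Finite] :
    phiK 6 3 * ({A : Set α | A ⊆ M.E ∧ M.eRk A = ((6 : ℕ) : ℕ∞) ∧ M.eRk (M.E \ A) = ((3 : ℕ) : ℕ∞)}.ncard : ℚ) ≤
      ({A : Set α | A ⊆ M.E ∧ ((3 : ℕ) : ℕ∞) < M.eRk A ∧ M.eRk A < ((6 : ℕ) : ℕ∞)}.ncard : ℚ) := by
  apply c025_six_three_of_P1_planar hP₁
  intro M _ hs hge hcol G hG hW5
  have hg3 : 3 ≤ G.card := SixThree.three_le_card_of_eRk_eq_three (ThmH.mem_planes.1 hG).2.2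
  rcases Nat.eq_or_lt_of_le hg3 with h3' | hg4
  · exact SixThree.planarIneqs_of_three_points hG h3'.symm
  · exact SixThree.planarIneqs_of_table hs hG hg4 (hTab M hs hge hcol G hG hW5 hg4)
      (h3 M hs hge hcol G hG hW5 hg4)

/-- **C-025 at `(6, 3)` on every finite matroid from Theorem P₁ and the profile tables.**  On every simple matroid of
rank `≥ 6` (coloop-free at rank `6`) and every plane `G` with `ρ(E ∖ G) ≤ 5` and `g ≥ 4` points, profile
`P = prof G` (`SixThreeProfile.lean`):
* `hT12`: `3 (N₃ − 1) ≤ FsumAdd 5 g P` and `3 (N₃ − 1 − (g − [g − 1 ∈ P])) ≤ FsumAdd 4 g P` (types `1`, `2`);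
* `hT3gen`: `3 (N₃ − C2gen) ≤ FsumAdd 3 g P` when `G` is not a union of two lines;
* `hT3two`: `3 (N₃ − C2gen + 2 · 2^{|L₁ ∩ L₂ ∩ G|}) ≤ FsumAdd 3 g P` for every two-line decomposition (`g ≥ 5`);
together with Theorem P₁ (`hP₁`) they give `Φ(6,3) · #U(6,3) ≤ #Y(6,3)` for every finite matroid. -/
theorem c025_six_three_of_P1_tables {α : Type} [DecidableEq α]
    (hP₁ : ∀ (M : Matroid α) [M.Finite], ThmH.Simple M → (6 : ℕ∞) ≤ M.eRank →
      (M.eRank = 6 → ∀ e, ¬ M.IsColoop e) → ∀ G ∈ ThmH.planes M, ∀ T ∈ PerFlat.UqG M 6 3 G, T.card = 3 →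
      ∀ W ⊆ ThmH.gr M \ G, M.Indep (W : Set α) → W.card = 6 →
      (3 : ℚ) ≤ ∑ S ∈ (PerFlat.Yq M 6 3).filter (fun S => S ∩ G = T ∧ S \ G ⊆ W),
        SixThree.fRule M G S / SixThree.D M S)
    (hT12 : ∀ (M : Matroid α) [M.Finite], ThmH.Simple M → (6 : ℕ∞) ≤ M.eRank →
      (M.eRank = 6 → ∀ e, ¬ M.IsColoop e) → ∀ G ∈ ThmH.planes M, M.eRk ((ThmH.gr M \ G : Finset α) : Set α) ≤ 5 → 4 ≤ G.card →
      SixThree.TableIneqAdd12 G.card (SixThree.prof M G))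
    (hT3gen : ∀ (M : Matroid α) [M.Finite], ThmH.Simple M → (6 : ℕ∞) ≤ M.eRank →
      (M.eRank = 6 → ∀ e, ¬ M.IsColoop e) → ∀ G ∈ ThmH.planes M, M.eRk ((ThmH.gr M \ G : Finset α) : Set α) ≤ 5 → 4 ≤ G.card →
      (∀ L ∈ SixThree.linesOf M G, M.eRk ((G \ L : Finset α) : Set α) = 3) →
      3 * ((SixThree.N3 G.card (SixThree.prof M G) : ℚ) - SixThree.C2gen G.card (SixThree.prof M G)) ≤
        SixThree.FsumAdd 3 G.card (SixThree.prof M G))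
    (hT3two : ∀ (M : Matroid α) [M.Finite], ThmH.Simple M → (6 : ℕ∞) ≤ M.eRank →
      (M.eRank = 6 → ∀ e, ¬ M.IsColoop e) → ∀ G ∈ ThmH.planes M, M.eRk ((ThmH.gr M \ G : Finset α) : Set α) ≤ 5 → 4 ≤ G.card →
      ∀ L₁ L₂, SixThree.TwoLines M G L₁ L₂ → 5 ≤ G.card →
      (∀ L ∈ SixThree.linesOf M G, (L ∩ G).card + 2 ≤ G.card) →
      3 * ((SixThree.N3 G.card (SixThree.prof M G) : ℚ) - SixThree.C2gen G.card (SixThree.prof M G) +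
        2 * 2 ^ (L₁ ∩ L₂ ∩ G).card) ≤ SixThree.FsumAdd 3 G.card (SixThree.prof M G))
    (M : Matroid α) [M.Finite] :
    phiK 6 3 * ({A : Set α | A ⊆ M.E ∧ M.eRk A = ((6 : ℕ) : ℕ∞) ∧ M.eRk (M.E \ A) = ((3 : ℕ) : ℕ∞)}.ncard : ℚ) ≤
      ({A : Set α | A ⊆ M.E ∧ ((3 : ℕ) : ℕ∞) < M.eRk A ∧ M.eRk A < ((6 : ℕ) : ℕ∞)}.ncard : ℚ) := by
  apply c025_six_three_of_P1_planar hP₁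
  intro M _ hs hge hcol G hG hW5
  have hg3 : 3 ≤ G.card := SixThree.three_le_card_of_eRk_eq_three (ThmH.mem_planes.1 hG).2.2
  rcases Nat.eq_or_lt_of_le hg3 with h3' | hg4
  · exact SixThree.planarIneqs_of_three_points hG h3'.symm
  · exact SixThree.planarIneqs_of_table hs hG hg4
      (SixThree.tableIneq12_of_add hs hG (hT12 M hs hge hcol G hG hW5 hg4))
      (fun _ => SixThree.planarIneq3_of_table hs hG hg4 (hT3gen M hs hge hcol G hG hW5 hg4)
        (hT3two M hs hge hcol G hG hW5 hg4))

/-- **C-025 at `(6, 3)` on every finite matroid from Theorem P₁ and the profile tables for `5 ≤ g`** — the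
`3`- and `4`-point planes are discharged internally (`planarIneqs_of_three_points`, `tableIneqAdd12_of_four`,
`planarIneq3_of_four`), so the table hypotheses are exactly p3's range `g ≥ 5`. -/
theorem c025_six_three_of_P1_tables5 {α : Type} [DecidableEq α]
    (hP₁ : ∀ (M : Matroid α) [M.Finite], ThmH.Simple M → (6 : ℕ∞) ≤ M.eRank →
      (M.eRank = 6 → ∀ e, ¬ M.IsColoop e) → ∀ G ∈ ThmH.planes M, ∀ T ∈ PerFlat.UqG M 6 3 G, T.card = 3 →
      ∀ W ⊆ ThmH.gr M \ G, M.Indep (W : Set α) → W.card = 6 →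
      (3 : ℚ) ≤ ∑ S ∈ (PerFlat.Yq M 6 3).filter (fun S => S ∩ G = T ∧ S \ G ⊆ W),
        SixThree.fRule M G S / SixThree.D M S)
    (hT12 : ∀ (M : Matroid α) [M.Finite], ThmH.Simple M → (6 : ℕ∞) ≤ M.eRank →
      (M.eRank = 6 → ∀ e, ¬ M.IsColoop e) → ∀ G ∈ ThmH.planes M,
      M.eRk ((ThmH.gr M \ G : Finset α) : Set α) ≤ 5 → 5 ≤ G.card →
      SixThree.TableIneqAdd12 G.card (SixThree.prof M G))
    (hT3gen : ∀ (M : Matroid α) [M.Finite], ThmH.Simple M → (6 : ℕ∞) ≤ M.eRank →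
      (M.eRank = 6 → ∀ e, ¬ M.IsColoop e) → ∀ G ∈ ThmH.planes M,
      M.eRk ((ThmH.gr M \ G : Finset α) : Set α) ≤ 5 → 5 ≤ G.card →
      (∀ L ∈ SixThree.linesOf M G, M.eRk ((G \ L : Finset α) : Set α) = 3) →
      3 * ((SixThree.N3 G.card (SixThree.prof M G) : ℚ) - SixThree.C2gen G.card (SixThree.prof M G)) ≤
        SixThree.FsumAdd 3 G.card (SixThree.prof M G))
    (hT3two : ∀ (M : Matroid α) [M.Finite], ThmH.Simple M → (6 : ℕ∞) ≤ M.eRank →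
      (M.eRank = 6 → ∀ e, ¬ M.IsColoop e) → ∀ G ∈ ThmH.planes M,
      M.eRk ((ThmH.gr M \ G : Finset α) : Set α) ≤ 5 → 5 ≤ G.card →
      ∀ L₁ L₂, SixThree.TwoLines M G L₁ L₂ →
      (∀ L ∈ SixThree.linesOf M G, (L ∩ G).card + 2 ≤ G.card) →
      3 * ((SixThree.N3 G.card (SixThree.prof M G) : ℚ) - SixThree.C2gen G.card (SixThree.prof M G) +
        2 * 2 ^ (L₁ ∩ L₂ ∩ G).card) ≤ SixThree.FsumAdd 3 G.card (SixThree.prof M G))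
    (M : Matroid α) [M.Finite] :
    phiK 6 3 * ({A : Set α | A ⊆ M.E ∧ M.eRk A = ((6 : ℕ) : ℕ∞) ∧ M.eRk (M.E \ A) = ((3 : ℕ) : ℕ∞)}.ncard : ℚ) ≤
      ({A : Set α | A ⊆ M.E ∧ ((3 : ℕ) : ℕ∞) < M.eRk A ∧ M.eRk A < ((6 : ℕ) : ℕ∞)}.ncard : ℚ) := by
  apply c025_six_three_of_P1_planar hP₁
  intro M _ hs hge hcol G hG hW5
  have hg3 : 3 ≤ G.card := SixThree.three_le_card_of_eRk_eq_three (ThmH.mem_planes.1 hG).2.2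
  rcases Nat.eq_or_lt_of_le hg3 with h3' | hg4
  · exact SixThree.planarIneqs_of_three_points hG h3'.symm
  · rcases Nat.eq_or_lt_of_le hg4 with h4' | hg5
    · exact SixThree.planarIneqs_of_table hs hG hg4
        (SixThree.tableIneq12_of_add hs hG (SixThree.tableIneqAdd12_of_four hs hG h4'.symm))
        (fun _ => SixThree.planarIneq3_of_four h4'.symm)
    · exact SixThree.planarIneqs_of_table hs hG hg4
        (SixThree.tableIneq12_of_add hs hG (hT12 M hs hge hcol G hG hW5 hg5))
        (fun _ => SixThree.planarIneq3_of_table hs hG hg4 (hT3gen M hs hge hcol G hG hW5 hg5)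
          (fun L₁ L₂ h12 _ hnl => hT3two M hs hge hcol G hG hW5 hg5 L₁ L₂ h12 hnl))

end PercRepro
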